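import Summits.Ventures.DiscreteObjects.Hadamard.ConferenceGraph333TwoCells
import Summits.Ventures.DiscreteObjects.Hadamard.ClassSumTrace

/-!
# Elements of order 4 in Aut(srg(333,166,82,83)): `#Fix(τ²) ≡ 2·#Fix(τ) + 3 (mod 8)` (kernel; census line)

Framing: lottery ticket; floor = certified bounds/negative ranges.  Cell pub-namedobj (venture DiscreteObjects),
target (H) = `H(668)`, hadamard gen 28; companion of `ConferenceGraph333Involution` (`#Fix ≡ 1 (mod 4)` for involutions).
* `mem_orb4_iff` — orbits `{x, τx, τ²x, τ³x}` of a permutation with `τ⁴ = 1` as finsets;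
* **`order4_fixedPoints_mod_eight`** — for an adjacency-preserving permutation `τ` of an `srg(333,166,82,83)` with
  `τ⁴ = 1` (pointwise): `#Fix(τ²) ≡ 2·#Fix(τ) + 3 (mod 8)`.  Proof: the `τ`-orbits (sizes 1, 2, 4) form an equitable
  partition; `Σ_i R_{ii} = 0` (`ClassSumTrace`); fixed points give `0`, `2`-orbits `{x, τx}` give `S_{x,τx} = ±1`,
  `4`-orbits give `S_{x,τx} + S_{x,τ²x} + S_{x,τ³x} = 2S_{x,τx} + S_{x,τ²x}`, odd; hence the number of non-trivial orbits
  `k₂ + k₄` is even, and with `#Fix τ² = a + 2k₂`, `333 = a + 2k₂ + 4k₄`, `a` odd this is the stated congruence;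
* **`no_order4_square_fixing_one`** — no adjacency-preserving `τ` with `τ⁴ = 1` has `#Fix(τ²) = 1` (then `#Fix τ ≤ 1`
  and `1 ≡ 2·#Fix τ + 3 (mod 8)` fails): an involution with a single fixed point has no square root in `Aut`.
Structure of a hypothetical object; no `sorry`, no new definitions.
-/

namespace Summit.Ventures.DiscreteObjects.Hadamard

open Finset

section order4
variable {V : Type*} [Fintype V] [DecidableEq V]

omit [Fintype V] in
/-- The orbit `{x, τx, τ²x, τ³x}` of a permutation with `τ⁴ = 1`, as a `Finset`; membership is 'same orbit'. -/
theorem mem_orb4_iff (τ : Equiv.Perm V) (hτ : ∀ x, τ (τ (τ (τ x))) = x) (x y : V) :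
    y ∈ ({x, τ x, τ (τ x), τ (τ (τ x))} : Finset V) ↔
      ({y, τ y, τ (τ y), τ (τ (τ y))} : Finset V) = {x, τ x, τ (τ x), τ (τ (τ x))} := by
  constructor
  · intro hy
    simp only [Finset.mem_insert, Finset.mem_singleton] at hy
    rcases hy with rfl | rfl | rfl | rfl
    · rfl
    · simp only [hτ]; ext z; simp only [Finset.mem_insert, Finset.mem_singleton]; tauto
    · simp only [hτ]; ext z; simp only [Finset.mem_insert, Finset.mem_singleton]; tauto
    · simp only [hτ]; ext z; simp only [Finset.mem_insert, Finset.mem_singleton]; tauto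
  · intro h
    rw [← h]
    simp

/-- `333` is not a square (private copy). -/
private theorem not_isSquare_333_o4 : ¬ IsSquare (333 : ℕ) := by
  rintro ⟨r, hr⟩
  have : r ≤ 19 := by nlinarith
  interval_cases r <;> omega

/-- **Order-4 law.**  For an adjacency-preserving permutation `τ` with `τ⁴ = 1` of an `srg(333,166,82,83)`:
`#Fix(τ²) ≡ 2·#Fix(τ) + 3 (mod 8)`. -/
theorem order4_fixedPoints_mod_eight (hV : Fintype.card V = 333) (A : Matrix V V ℤ)
    (h01 : ∀ x y, A x y = 0 ∨ A x y = 1) (hsymm : ∀ x y, A y x = A x y) (hdiag : ∀ x, A x x = 0)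
    (hk : ∀ x, ∑ y, A x y = 166) (hsrg : ∀ x y, ∑ z, A x z * A z y = 83 * (1 + (if x = y then 1 else 0)) - A x y)
    (τ : Equiv.Perm V) (hτ : ∀ x, τ (τ (τ (τ x))) = x) (hA : ∀ x y, A (τ x) (τ y) = A x y) :
    (univ.filter fun x => τ (τ x) = x).card % 8 = (2 * (univ.filter fun x => τ x = x).card + 3) % 8 := by
  classical
  obtain ⟨hSd, hSo, hSs, hS1, hSS⟩ := seidel_identities_of_conferenceGraph A h01 hsymm hdiag 83
    (by rw [hV]; norm_num) (fun x => by rw [hk x]; norm_num) hsrg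
  set S : V → V → ℤ := fun x y => 1 - (if x = y then 1 else 0) - 2 * A x y with hS_def
  have hSS' : ∀ x y, ∑ z, S x z * S z y = 333 * (if x = y then 1 else 0) - 1 := fun x y => by
    rw [hSS x y, hV]; norm_num
  have hSτ : ∀ x y, S (τ x) (τ y) = S x y := fun x y => by
    simp only [hS_def, hA, τ.injective.eq_iff]
  have hSd' : ∀ x, S x x = 0 := fun x => hSd x
  have hSo' : ∀ x y, x ≠ y → S x y = 1 ∨ S x y = -1 := fun x y => hSo x y
  have hSs' : ∀ x y, S y x = S x y := fun x y => hSs x y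
  -- orbits
  set orb : V → Finset V := fun x => {x, τ x, τ (τ x), τ (τ (τ x))} with horb_def
  have horb_mem : ∀ x y, y ∈ orb x ↔ orb y = orb x := fun x y => mem_orb4_iff τ hτ x y
  have horb_τ : ∀ y, orb (τ y) = orb y := fun y => (horb_mem y (τ y)).mp (by simp [horb_def])
  set ι := {j : Finset V // j ∈ univ.image orb} with hι_def
  set cls : V → ι := fun x => ⟨orb x, Finset.mem_image_of_mem _ (Finset.mem_univ x)⟩ with hcls_def
  have hcls_eq : ∀ x y, cls y = cls x ↔ orb y = orb x := fun x y => by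
    rw [hcls_def, Subtype.mk.injEq]
  have hcls_τ : ∀ y, cls (τ y) = cls y := fun y => (hcls_eq y (τ y)).mpr (horb_τ y)
  have hcell : ∀ x, (univ.filter fun y => cls y = cls x) = orb x := by
    intro x; ext y
    rw [Finset.mem_filter, hcls_eq, ← horb_mem]
    simp
  have hrep : ∀ i : ι, ∃ x, cls x = i := by
    rintro ⟨j, hj⟩
    obtain ⟨x, -, hx⟩ := Finset.mem_image.mp hj
    exact ⟨x, Subtype.ext hx⟩
  choose rep hrep using hrep
  have hcellrep : ∀ i : ι, (univ.filter fun y => cls y = i) = orb (rep i) := fun i => by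
    rw [← hcell (rep i), hrep]
  set R : Matrix ι ι ℤ := fun i j => ∑ y ∈ univ.filter (fun y => cls y = j), S (rep i) y with hR_def
  have hshift : ∀ r (j : ι), ∑ y ∈ univ.filter (fun y => cls y = j), S (τ r) y =
      ∑ y ∈ univ.filter (fun y => cls y = j), S r y := by
    intro r j
    rw [Finset.sum_filter, Finset.sum_filter]
    exact Fintype.sum_equiv τ.symm _ _ fun y => by
      rw [show cls y = cls (τ (τ.symm y)) by rw [Equiv.apply_symm_apply], hcls_τ,
        show S (τ r) y = S (τ r) (τ (τ.symm y)) by rw [Equiv.apply_symm_apply], hSτ]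
  have key : ∀ (r x' : V) (j : ι), x' ∈ orb r →
      ∑ y ∈ univ.filter (fun y => cls y = j), S x' y = ∑ y ∈ univ.filter (fun y => cls y = j), S r y := by
    intro r x' j hx'
    simp only [horb_def, Finset.mem_insert, Finset.mem_singleton] at hx'
    rcases hx' with rfl | rfl | rfl | rfl
    · rfl
    · exact hshift r j
    · rw [hshift, hshift]
    · rw [hshift, hshift, hshift]
  have hR : ∀ x j, ∑ y ∈ univ.filter (fun y => cls y = j), S x y = R (cls x) j := by
    intro x j
    have hx : x ∈ orb (rep (cls x)) := by rw [horb_mem, ← hcls_eq, hrep]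
    exact key _ _ j hx
  have hids := fun i k => seidel333_classSum_identities S hSs hS1 hSS' cls R hR i k (rep i) (hrep i)
  have htr : ∑ i, R i i = 0 := by
    refine classSum_trace_zero R 333 not_isSquare_333_o4 (fun k => ((univ.filter fun y => cls y = k).card : ℤ))
      (fun i => (hids i i).1) fun i k => ?_
    rw [(hids i k).2.1]
    push_cast
    ring
  -- per-orbit facts; P i : fixed, Q i : 2-orbit
  have hdiag_fixed : ∀ i, τ (rep i) = rep i → R i i = 0 := by
    intro i hfix
    have h0 : R i i = ∑ y ∈ orb (rep i), S (rep i) y := by rw [hR_def]; simp only; rw [hcellrep]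
    rw [h0]; simp only [horb_def]
    rw [hfix, hfix, hfix, Finset.insert_eq_of_mem (by simp), Finset.insert_eq_of_mem (by simp),
      Finset.insert_eq_of_mem (by simp), Finset.sum_singleton]
    exact hSd' _
  have horb2 : ∀ r, τ r ≠ r → τ (τ r) = r → orb r = {r, τ r} := by
    intro r h1 h2
    simp only [horb_def]; rw [h2, Finset.insert_eq_of_mem (by simp)]
    ext z; simp only [Finset.mem_insert, Finset.mem_singleton]; tauto
  have hdist4 : ∀ r, τ (τ r) ≠ r → r ≠ τ r ∧ r ≠ τ (τ r) ∧ r ≠ τ (τ (τ r)) ∧ τ r ≠ τ (τ r) ∧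
      τ r ≠ τ (τ (τ r)) ∧ τ (τ r) ≠ τ (τ (τ r)) := by
    intro r h2
    have h1 : τ r ≠ r := fun h => h2 (by rw [h, h])
    refine ⟨fun h => h1 h.symm, fun h => h2 h.symm, fun h => h1 ?_, fun h => h1 (τ.injective h).symm,
      fun h => h2 (τ.injective h).symm, fun h => h1 (τ.injective (τ.injective h)).symm⟩
    have := congrArg τ h; rw [hτ] at this; exact this
  have hdiag_odd : ∀ i, τ (rep i) ≠ rep i → ((R i i : ℤ) : ZMod 2) = 1 := by
    intro i hfix
    have h0 : R i i = ∑ y ∈ orb (rep i), S (rep i) y := by rw [hR_def]; simp only; rw [hcellrep]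
    rw [h0]
    by_cases h2 : τ (τ (rep i)) = rep i
    · rw [horb2 (rep i) hfix h2, Finset.sum_pair (fun h => hfix h.symm), hSd', zero_add]
      rcases hSo' (rep i) (τ (rep i)) (fun h => hfix h.symm) with e | e <;> rw [e] <;> decide
    · obtain ⟨d1, d2, d3, d4, d5, d6⟩ := hdist4 (rep i) h2
      simp only [horb_def]
      rw [Finset.sum_insert (by simp [d1, d2, d3]), Finset.sum_insert (by simp [d4, d5]), Finset.sum_pair d6, hSd',
        zero_add]
      have e3 : S (rep i) (τ (τ (τ (rep i)))) = S (rep i) (τ (rep i)) := by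
        rw [← hSτ (rep i) (τ (τ (τ (rep i)))), hτ, hSs']
      rw [e3, Int.cast_add, Int.cast_add]
      rcases hSo' (rep i) (τ (rep i)) d1 with e | e <;>
        rcases hSo' (rep i) (τ (τ (rep i))) d2 with e' | e' <;> rw [e, e'] <;> decide
  -- the set T of non-trivial orbits has even size
  set T := (univ : Finset ι).filter (fun i => ¬ τ (rep i) = rep i) with hT_def
  have hTeven : 2 ∣ T.card := by
    have hsplit : ∑ i, R i i = ∑ i ∈ T, R i i := by
      rw [hT_def, Finset.sum_filter]
      refine Finset.sum_congr rfl fun i _ => ?_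
      by_cases h : τ (rep i) = rep i
      · simp [h, hdiag_fixed i h]
      · simp [h]
    have hcast : ((∑ i ∈ T, R i i : ℤ) : ZMod 2) = (T.card : ZMod 2) := by
      rw [Int.cast_sum, Finset.card_eq_sum_ones, Nat.cast_sum]
      refine Finset.sum_congr rfl fun i hi => ?_
      rw [Nat.cast_one]
      exact hdiag_odd i (Finset.mem_filter.mp hi).2
    rw [← hsplit, htr, Int.cast_zero] at hcast
    exact (ZMod.natCast_eq_zero_iff _ 2).mp hcast.symm
  -- counting: sizes and fixed points of τ, τ² per orbit
  have horb_card : ∀ i, (orb (rep i)).card =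
      if τ (rep i) = rep i then 1 else if τ (τ (rep i)) = rep i then 2 else 4 := by
    intro i
    split_ifs with h1 h2
    · simp only [horb_def]; rw [h1, h1, h1]; simp
    · rw [horb2 (rep i) h1 h2, Finset.card_pair (fun h => h1 h.symm)]
    · obtain ⟨d1, d2, d3, d4, d5, d6⟩ := hdist4 (rep i) h2
      simp only [horb_def]
      rw [Finset.card_insert_of_notMem (by simp [d1, d2, d3]), Finset.card_insert_of_notMem (by simp [d4, d5]),
        Finset.card_pair d6]
  have horb_fix1 : ∀ i, ((orb (rep i)).filter fun y => τ y = y).card = if τ (rep i) = rep i then 1 else 0 := by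
    intro i
    split_ifs with h1
    · simp only [horb_def]
      rw [h1, h1, h1, Finset.insert_eq_of_mem (by simp), Finset.insert_eq_of_mem (by simp),
        Finset.insert_eq_of_mem (by simp), Finset.filter_singleton, if_pos h1, Finset.card_singleton]
    · rw [Finset.card_eq_zero, Finset.filter_eq_empty_iff]
      intro y hy
      have hy' : orb y = orb (rep i) := (horb_mem (rep i) y).mp hy
      intro e
      apply h1
      -- y fixed ⇒ orb y = {y} ⇒ rep i = y ⇒ fixed
      have hsingle : orb y = {y} := by simp only [horb_def]; rw [e, e, e]; simp
      have hmem : rep i ∈ orb y := by rw [hy']; simp [horb_def]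
      rw [hsingle, Finset.mem_singleton] at hmem
      rw [hmem, e]
  have horb_fix2 : ∀ i, ((orb (rep i)).filter fun y => τ (τ y) = y).card =
      if τ (rep i) = rep i then 1 else if τ (τ (rep i)) = rep i then 2 else 0 := by
    intro i
    split_ifs with h1 h2
    · simp only [horb_def]
      rw [h1, h1, h1, Finset.insert_eq_of_mem (by simp), Finset.insert_eq_of_mem (by simp),
        Finset.insert_eq_of_mem (by simp), Finset.filter_singleton, if_pos (by rw [h1, h1]), Finset.card_singleton]
    · rw [horb2 (rep i) h1 h2, Finset.filter_true_of_mem, Finset.card_pair (fun h => h1 h.symm)]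
      intro y hy
      simp only [Finset.mem_insert, Finset.mem_singleton] at hy
      rcases hy with rfl | rfl
      · exact h2
      · rw [h2]
    · rw [Finset.card_eq_zero, Finset.filter_eq_empty_iff]
      intro y hy
      simp only [horb_def, Finset.mem_insert, Finset.mem_singleton] at hy
      intro e
      apply h2
      rcases hy with rfl | rfl | rfl | rfl
      · exact e
      · exact τ.injective e
      · rw [hτ] at e; exact e.symm
      · rw [hτ] at e; exact (τ.injective e).symm
  have h333 : (333 : ℕ) = ∑ i : ι, (orb (rep i)).card := by
    rw [← hV, ← Finset.card_univ, Finset.card_eq_sum_card_fiberwise (f := cls) (t := univ)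
      fun _ _ => Finset.mem_univ _]
    exact Finset.sum_congr rfl fun i _ => by rw [hcellrep]
  have hfixsum : ∀ (P : V → Prop) [DecidablePred P],
      (univ.filter P).card = ∑ i : ι, ((orb (rep i)).filter P).card := by
    intro P _
    rw [Finset.card_eq_sum_card_fiberwise (f := cls) (s := univ.filter P) (t := univ) fun _ _ => Finset.mem_univ _]
    refine Finset.sum_congr rfl fun i _ => congrArg Finset.card ?_
    ext y
    rw [Finset.mem_filter, Finset.mem_filter, Finset.mem_filter, ← hcellrep i, Finset.mem_filter]
    tauto
  have ha := hfixsum (fun x => τ x = x)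
  have hb := hfixsum (fun x => τ (τ x) = x)
  simp only [horb_fix1] at ha
  simp only [horb_fix2] at hb
  rw [Finset.sum_congr rfl fun i _ => horb_card i] at h333
  -- evaluate the three sums
  rw [Finset.sum_ite, Finset.sum_const, Finset.sum_ite, Finset.sum_const, Finset.sum_const] at h333 hb
  rw [Finset.sum_ite, Finset.sum_const, Finset.sum_const] at ha
  simp only [smul_eq_mul, mul_one, mul_zero, add_zero] at h333 ha hb
  have hT2 : ((univ.filter fun i : ι => ¬ τ (rep i) = rep i).filter fun i => τ (τ (rep i)) = rep i).card +
      ((univ.filter fun i : ι => ¬ τ (rep i) = rep i).filter fun i => ¬ τ (τ (rep i)) = rep i).card = T.card := by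
    rw [hT_def]; exact Finset.card_filter_add_card_filter_not _
  obtain ⟨m, hm⟩ := hTeven
  omega

/-- **No automorphism of order 4 whose square fixes exactly one vertex** (more generally `#Fix(τ²) = 1` forces
`2·#Fix(τ) + 3 ≡ 1 (mod 8)` with `#Fix(τ) ≤ 1`, impossible). -/
theorem no_order4_square_fixing_one (hV : Fintype.card V = 333) (A : Matrix V V ℤ)
    (h01 : ∀ x y, A x y = 0 ∨ A x y = 1) (hsymm : ∀ x y, A y x = A x y) (hdiag : ∀ x, A x x = 0)
    (hk : ∀ x, ∑ y, A x y = 166) (hsrg : ∀ x y, ∑ z, A x z * A z y = 83 * (1 + (if x = y then 1 else 0)) - A x y)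
    (τ : Equiv.Perm V) (hτ : ∀ x, τ (τ (τ (τ x))) = x) (hA : ∀ x y, A (τ x) (τ y) = A x y)
    (h1 : (univ.filter fun x => τ (τ x) = x).card = 1) : False := by
  have h := order4_fixedPoints_mod_eight hV A h01 hsymm hdiag hk hsrg τ hτ hA
  have hle : (univ.filter fun x => τ x = x).card ≤ (univ.filter fun x => τ (τ x) = x).card :=
    Finset.card_le_card fun x hx => by
      rw [Finset.mem_filter] at hx ⊢
      exact ⟨hx.1, by rw [hx.2, hx.2]⟩
  rw [h1] at h hle
  omega

end order4

end Summit.Ventures.DiscreteObjects.Hadamard
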